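import Mathlib.LinearAlgebra.LinearIndependent.Lemmas
import Literature.NumberTheory.Transcendental.LogLatticeSlices
import HarnessLib

/-!
# Rigidity of plane curves through `u + 2πi ℚ²`: the main statement

Let `c = 2πi`, `u ∈ ℂ²` with `e^{u₀}, e^{u₁}` algebraic, `G ∈ ℚ̄[X₀, X₁]` non-zero and
`S ∈ ℚ[V₀, V₁]` with `G(u + cV) = μ · S(V)` (as `bind₁ (Xᵢ ↦ uᵢ + c Xᵢ) G = C μ * S`). Then every
zero of `G` of the form `x = u + c v`, `v ∈ ℚ²`, has `ℚ`-linearly dependent coordinates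
(`not_linearIndependent_of_bind₁_affine_eq`). According to the `ℚ`-linear relations among
`(u₀, u₁, c)`: if `u₀, u₁ ∈ ℚ c` every `u + c v` lies in `(ℚ c)²`; if there is no relation
`p u₀ + q u₁ ∈ ℚ c` with `(p, q) ≠ 0`, the identity forces `G` to be a non-zero constant
(`false_of_bind₁_affine_eq_of_forall` and the engine); if there is one such relation
`p u₀ + q u₁ = r c`, a rational linear change of coordinates making `p X₀ + q X₁` the outer
variable reduces to the normalised case (`eq_C_mul_X_pow_of_bind₁_affine_eq`), so every zero `x`
has `p x₀ + q x₁ = 0`. Only Hermite–Lindemann and the transcendence of `π` are used.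
-/
noncomputable section

open Polynomial Complex
open Literature.Algebra.Polynomial

namespace Literature.NumberTheory.Transcendental.LogLattice

/-! ### Polynomials with coefficients in a subalgebra -/

section Coeffs

variable {R S₁ S₂ : Type*} [CommSemiring R] [CommSemiring S₁] [CommSemiring S₂]
  [Algebra R S₁] [Algebra R S₂] {σ τ : Type*}

/-- `p` lies in the range of `mapAlgHom f` iff all its coefficients lie in the range of `f`.
[folklore] -/
theorem mem_range_mapAlgHom_iff (f : S₁ →ₐ[R] S₂) (p : MvPolynomial σ S₂) :
    p ∈ (MvPolynomial.mapAlgHom (σ := σ) f).range ↔ ∀ m, p.coeff m ∈ f.range := by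
  rw [← Subalgebra.mem_toSubmodule, MvPolynomial.range_mapAlgHom, MvPolynomial.mem_coeffsIn]
  rfl

/-- Substituting polynomials with coefficients in the range of `f` into a polynomial with
coefficients in the range of `f` gives a polynomial with coefficients there. [folklore] -/
theorem bind₁_mem_range_mapAlgHom (f : S₁ →ₐ[R] S₂) {p : MvPolynomial σ S₂}
    (hp : p ∈ (MvPolynomial.mapAlgHom (σ := σ) f).range) {φ : σ → MvPolynomial τ S₂}
    (hφ : ∀ i, φ i ∈ (MvPolynomial.mapAlgHom (σ := τ) f).range) :
    MvPolynomial.bind₁ φ p ∈ (MvPolynomial.mapAlgHom (σ := τ) f).range := by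
  rw [mem_range_mapAlgHom_iff] at hp
  change MvPolynomial.aeval φ p ∈ _
  rw [MvPolynomial.aeval_def, MvPolynomial.algebraMap_eq]
  refine MvPolynomial.eval₂_mem (fun m _ => ?_) hφ
  obtain ⟨y, hy⟩ := hp m
  refine ⟨MvPolynomial.C y, ?_⟩
  change MvPolynomial.map (f : S₁ →+* S₂) (MvPolynomial.C y) = _
  rw [MvPolynomial.map_C]
  exact congrArg MvPolynomial.C hy

end Coeffs

/-! ### Algebraic and rational coefficients over `ℂ` -/

/-- All coefficients of `G` are algebraic iff `G` has coefficients in `ℚ̄ = algebraicClosure ℚ ℂ`.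
[folklore] -/
theorem forall_isAlgebraic_coeff_iff (G : MvPolynomial (Fin 2) ℂ) :
    (∀ m, IsAlgebraic ℚ (G.coeff m)) ↔
      G ∈ (MvPolynomial.mapAlgHom (σ := Fin 2) (algebraicClosure ℚ ℂ).val).range := by
  rw [mem_range_mapAlgHom_iff]
  refine forall_congr' fun m => ?_
  rw [← mem_algebraicClosure_iff]
  constructor
  · intro h
    exact ⟨⟨G.coeff m, h⟩, rfl⟩
  · rintro ⟨y, hy⟩
    rw [← hy]
    exact y.2

/-- All coefficients of `S` are rational iff `S` has coefficients in the image of `ℚ`. [folklore] -/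
theorem forall_exists_rat_coeff_iff (S : MvPolynomial (Fin 2) ℂ) :
    (∀ m, ∃ q : ℚ, S.coeff m = q) ↔
      S ∈ (MvPolynomial.mapAlgHom (σ := Fin 2) (Algebra.ofId ℚ ℂ)).range := by
  rw [mem_range_mapAlgHom_iff]
  refine forall_congr' fun m => ?_
  constructor
  · rintro ⟨q, hq⟩
    exact ⟨q, by rw [hq]; exact (eq_ratCast _ q)⟩
  · rintro ⟨q, hq⟩
    exact ⟨q, by rw [← hq]; exact (eq_ratCast _ q)⟩

/-- `X i` has rational (hence algebraic) coefficients. [folklore] -/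
theorem X_mem_range_mapAlgHom {S₁ : Type*} [CommSemiring S₁] [Algebra ℚ S₁] (f : S₁ →ₐ[ℚ] ℂ)
    (i : Fin 2) : (MvPolynomial.X i : MvPolynomial (Fin 2) ℂ) ∈
      (MvPolynomial.mapAlgHom (σ := Fin 2) f).range :=
  ⟨MvPolynomial.X i, by simp⟩

/-- `C q` for rational `q` lies in the range of any `mapAlgHom f`, `f` a `ℚ`-algebra map.
[folklore] -/
theorem C_rat_mem_range_mapAlgHom {S₁ : Type*} [CommSemiring S₁] [Algebra ℚ S₁]
    (f : S₁ →ₐ[ℚ] ℂ) (q : ℚ) : (MvPolynomial.C (q : ℂ) : MvPolynomial (Fin 2) ℂ) ∈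
      (MvPolynomial.mapAlgHom (σ := Fin 2) f).range := by
  refine ⟨MvPolynomial.C (algebraMap ℚ S₁ q), ?_⟩
  change MvPolynomial.map (f : S₁ →+* ℂ) (MvPolynomial.C (algebraMap ℚ S₁ q)) = _
  rw [MvPolynomial.map_C]
  congr 1
  simp
/-! ### Linear dependence of pairs -/

/-- A non-trivial rational relation `p x₀ + q x₁ = 0` makes `x : Fin 2 → ℂ` linearly dependent.
[folklore] -/
theorem not_linearIndependent_of_rel {x : Fin 2 → ℂ} (p q : ℚ) (h0 : p ≠ 0 ∨ q ≠ 0)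
    (h : (p : ℂ) * x 0 + q * x 1 = 0) : ¬ LinearIndependent ℚ x := by
  intro hli
  have hx : x = ![x 0, x 1] := by
    ext j
    fin_cases j <;> rfl
  rw [hx, LinearIndependent.pair_iff] at hli
  have := hli p q (by rw [Rat.smul_def, Rat.smul_def]; exact h)
  rcases h0 with hp | hq
  · exact hp this.1
  · exact hq this.2

/-- Evaluating `bind₁ φ G` at `x` evaluates `G` at the values of the `φ i`. [folklore] -/
theorem eval_bind₁ {σ τ : Type*} (x : τ → ℂ) (φ : σ → MvPolynomial τ ℂ) (G : MvPolynomial σ ℂ) :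
    MvPolynomial.eval x (MvPolynomial.bind₁ φ G) =
      MvPolynomial.eval (fun i => MvPolynomial.eval x (φ i)) G :=
  MvPolynomial.eval₂Hom_bind₁ _ _ _ _
/-! ### The main statement -/

/-- If `u₀, u₁ ∈ ℚ · c` then every `u + c v` (`v ∈ ℚ²`) is `ℚ`-linearly dependent. [folklore] -/
theorem not_linearIndependent_of_mem_span {u : Fin 2 → ℂ} {c : ℂ} (q₀ q₁ : ℚ)
    (h₀ : u 0 = q₀ * c) (h₁ : u 1 = q₁ * c) (v : Fin 2 → ℚ) :
    ¬ LinearIndependent ℚ (fun j => u j + c * v j) := by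
  by_cases hz : q₀ + v 0 = 0
  · refine not_linearIndependent_of_rel 1 0 (Or.inl one_ne_zero) ?_
    have : (q₀ : ℂ) = -(v 0 : ℂ) := by exact_mod_cast (eq_neg_of_add_eq_zero_left hz)
    simp only [h₀, this]
    push_cast
    ring
  · refine not_linearIndependent_of_rel (q₁ + v 1) (-(q₀ + v 0)) (Or.inr (neg_ne_zero.2 hz)) ?_
    simp only [h₀, h₁]
    push_cast
    ring

/-- **Rigidity of plane curves through a coset of the period lattice.** Let `c = 2πi`, `u ∈ ℂ²`
with `e^{u₀}, e^{u₁}` algebraic, `G ∈ ℚ̄[X₀, X₁]` non-zero (all coefficients algebraic) and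
`S ∈ ℚ[V₀, V₁]` (all coefficients rational) with `G(u + cV) = μ S(V)`. Then every zero of `G` of
the form `u + c v` with `v ∈ ℚ²` is `ℚ`-linearly dependent. (Hermite–Lindemann and the
transcendence of `π`, via a descent on the slices of `G`; no Baker.) [cite: Lindemann1882] -/
theorem not_linearIndependent_of_bind₁_affine_eq {u : Fin 2 → ℂ} {μ : ℂ}
    (hu : ∀ j, IsAlgebraic ℚ (exp (u j)))
    (G S : MvPolynomial (Fin 2) ℂ) (hG : ∀ m, IsAlgebraic ℚ (G.coeff m))
    (hS : ∀ m, ∃ q : ℚ, S.coeff m = q) (hG0 : G ≠ 0)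
    (h : MvPolynomial.bind₁ (fun i => MvPolynomial.C (u i) +
        MvPolynomial.C (2 * (Real.pi : ℂ) * I) * MvPolynomial.X i) G = MvPolynomial.C μ * S)
    (v : Fin 2 → ℚ)
    (hv : MvPolynomial.eval (fun j => u j + 2 * (Real.pi : ℂ) * I * v j) G = 0) :
    ¬ LinearIndependent ℚ (fun j => u j + 2 * (Real.pi : ℂ) * I * v j) := by
  set c : ℂ := 2 * (Real.pi : ℂ) * I with hc
  clear_value c
  have hc0 : c ≠ 0 := hc ▸ Complex.two_pi_I_ne_zero
  set x : Fin 2 → ℂ := fun j => u j + c * v j with hx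
  -- Case 1: `u₀, u₁ ∈ ℚ c`
  by_cases hr1 : ∃ q₀ q₁ : ℚ, u 0 = q₀ * c ∧ u 1 = q₁ * c
  · obtain ⟨q₀, q₁, h₀, h₁⟩ := hr1
    exact not_linearIndependent_of_mem_span q₀ q₁ h₀ h₁ v
  -- the subalgebras of polynomials with algebraic / rational coefficients
  set TK := (MvPolynomial.mapAlgHom (σ := Fin 2) (algebraicClosure ℚ ℂ).val).range with hTK
  set TQ := (MvPolynomial.mapAlgHom (σ := Fin 2) (Algebra.ofId ℚ ℂ)).range with hTQ
  have hGT : G ∈ TK := (forall_isAlgebraic_coeff_iff G).1 hG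
  have hST : S ∈ TQ := (forall_exists_rat_coeff_iff S).1 hS
  -- Case 2: no relation `p u₀ + q u₁ ∈ ℚ c` with `(p, q) ≠ 0`
  by_cases hB : ∀ p q r : ℚ, (p : ℂ) * u 0 + q * u 1 = r * c → p = 0 ∧ q = 0
  · exfalso
    by_cases hJ : (((MvPolynomial.finSuccEquiv ℂ 1).trans
        (Polynomial.mapAlgEquiv (MvPolynomial.uniqueAlgEquiv ℂ (Fin 1)))) G).natDegree = 0
    · -- `G` does not involve `X₀`: it is a polynomial `G₀(X₁)`, constant by the engine
      have hind1 : ∀ q r : ℚ, (q : ℂ) * u 1 + r * c = 0 → q = 0 := by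
        intro q r hqr
        exact (hB 0 q (-r) (by push_cast; linear_combination hqr)).2
      set P := ((MvPolynomial.finSuccEquiv ℂ 1).trans
        (Polynomial.mapAlgEquiv (MvPolynomial.uniqueAlgEquiv ℂ (Fin 1)))) G with hP
      set Q := ((MvPolynomial.finSuccEquiv ℂ 1).trans
        (Polynomial.mapAlgEquiv (MvPolynomial.uniqueAlgEquiv ℂ (Fin 1)))) S with hQ
      set G₀ : ℂ[X] := P.coeff 0 with hG₀
      have hPC : P = C G₀ := eq_C_of_natDegree_eq_zero hJ
      have hslice : (P.map (Polynomial.compRingHom (C (u 1) + C c * X))).comp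
          (C (C (u 0)) + C (C c) * X) = C (C μ) * Q := by
        have := congrArg ((MvPolynomial.finSuccEquiv ℂ 1).trans
          (Polynomial.mapAlgEquiv (MvPolynomial.uniqueAlgEquiv ℂ (Fin 1)))) h
        rw [finTwoSlice_bind₁_affine, map_mul, finTwoSlice_C] at this
        exact this
      rw [hPC, Polynomial.map_C, Polynomial.coe_compRingHom_apply, C_comp] at hslice
      have h0 : G₀.comp (C (u 1) + C c * X) = C μ * Q.coeff 0 := by
        have hm : (C (G₀.comp (C (u 1) + C c * X)) : ℂ[X][X]).coeff 0 = (C (C μ) * Q).coeff 0 := by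
          rw [hslice]
        simp only [coeff_C_zero, coeff_C_mul] at hm
        exact hm
      subst hc
      have hG₀alg : ∀ n, IsAlgebraic ℚ (G₀.coeff n) := fun n =>
        isAlgebraic_coeff_coeff_slice hG 0 n
      have hQrat : ∀ n, ∃ q : ℚ, (Q.coeff 0).coeff n = q := fun n =>
        exists_rat_coeff_coeff_slice hS 0 n
      have hconst : G₀.natDegree = 0 :=
        natDegree_eq_zero_of_comp_affine_eq (hu 1) hind1 G₀ hG₀alg _ hQrat h0
      set γ : ℂ := G₀.coeff 0 with hγ
      have hGC : G = MvPolynomial.C γ := by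
        have h1 : G = MvPolynomial.C γ * MvPolynomial.X 0 ^ 0 := by
          refine eq_C_mul_X_pow_of_finTwoSlice_eq G γ 0 ?_
          rw [← hP, hPC, eq_C_of_natDegree_eq_zero hconst, ← hγ, pow_zero, mul_one]
        rw [h1, pow_zero, mul_one]
      have hγ0 : γ ≠ 0 := by
        intro h0'
        exact hG0 (by rw [hGC, h0', map_zero])
      apply hγ0
      rw [hGC, MvPolynomial.eval_C] at hv
      exact hv
    · subst hc
      exact false_of_bind₁_affine_eq_of_forall hu hB G S hG hS h hJ
  -- Case 3: exactly one relation `p u₀ + q u₁ = r c`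
  push Not at hB
  obtain ⟨p, q, r, hrel, hpq⟩ := hB
  by_cases hq : q = 0
  · -- relation `p u₀ = r c`, `p ≠ 0`: shift `u₀` to `0`
    subst hq
    have hp : p ≠ 0 := fun hp => hpq hp rfl
    have hp' : (p : ℂ) ≠ 0 := by exact_mod_cast hp
    have hu0 : u 0 = (r / p : ℚ) * c := by
      push_cast
      field_simp
      linear_combination hrel
    have hind : ∀ q' r' : ℚ, (q' : ℂ) * u 1 + r' * c = 0 → q' = 0 := by
      intro q' r' hqr
      by_contra hq'
      apply hr1
      refine ⟨r / p, -r' / q', hu0, ?_⟩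
      have hq'' : (q' : ℂ) ≠ 0 := by exact_mod_cast hq'
      push_cast
      field_simp
      linear_combination hqr
    -- the shifted identity
    let ψ : Fin 2 → MvPolynomial (Fin 2) ℂ :=
      ![MvPolynomial.X 0 - MvPolynomial.C ((r / p : ℚ) : ℂ), MvPolynomial.X 1]
    have hψT : ∀ i, ψ i ∈ TQ := by
      intro i
      fin_cases i
      · exact Subalgebra.sub_mem _ (X_mem_range_mapAlgHom _ 0) (C_rat_mem_range_mapAlgHom _ _)
      · exact X_mem_range_mapAlgHom _ 1
    set S' := MvPolynomial.bind₁ ψ S with hS'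
    have hS'T : ∀ m, ∃ q : ℚ, S'.coeff m = q :=
      (forall_exists_rat_coeff_iff S').2 (bind₁_mem_range_mapAlgHom _ hST hψT)
    have h' : MvPolynomial.bind₁ (fun i => MvPolynomial.C ((![0, u 1] : Fin 2 → ℂ) i) +
        MvPolynomial.C c * MvPolynomial.X i) G = MvPolynomial.C μ * S' := by
      have key : (fun i => MvPolynomial.C ((![0, u 1] : Fin 2 → ℂ) i) +
          MvPolynomial.C c * MvPolynomial.X i) =
          (fun i => MvPolynomial.bind₁ ψ (MvPolynomial.C (u i) + MvPolynomial.C c * MvPolynomial.X i)) := by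
        funext i
        fin_cases i
        · apply MvPolynomial.funext
          intro z
          simp [ψ, hu0]
          ring
        · simp [ψ]
      rw [key, ← MvPolynomial.bind₁_bind₁, h, map_mul, MvPolynomial.bind₁_C_right]
    subst hc
    obtain ⟨γ, J, hγ0, -, hGJ⟩ :=
      eq_C_mul_X_pow_of_bind₁_affine_eq (hu 1) hind G S' hG hS'T hG0 h'
    -- evaluate at the point
    have hx0 : x 0 = 0 := by
      have h1 : MvPolynomial.eval x G = γ * x 0 ^ J := by
        rw [hGJ]; simp
      rw [hx] at h1
      rw [hv] at h1
      have h2 : x 0 ^ J = 0 := by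
        rcases mul_eq_zero.1 h1.symm with h | h
        · exact absurd h hγ0
        · exact h
      exact (pow_eq_zero_iff'.1 h2).1
    exact not_linearIndependent_of_rel 1 0 (Or.inl one_ne_zero) (by rw [hx0]; push_cast; ring)
  · -- relation with `q ≠ 0`: new coordinates `(p X₀ + q X₁, X₀)`
    have hq' : (q : ℂ) ≠ 0 := by exact_mod_cast hq
    have hind : ∀ q' r' : ℚ, (q' : ℂ) * u 0 + r' * c = 0 → q' = 0 := by
      intro q' r' hqr
      by_contra hq0
      apply hr1
      have hq0' : (q' : ℂ) ≠ 0 := by exact_mod_cast hq0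
      refine ⟨-r' / q', (r + p * r' / q') / q, ?_, ?_⟩
      · push_cast
        field_simp
        linear_combination hqr
      · push_cast
        field_simp
        linear_combination (q' : ℂ) * hrel - (p : ℂ) * hqr
    -- the substitutions
    let φ : Fin 2 → MvPolynomial (Fin 2) ℂ :=
      ![MvPolynomial.X 1, MvPolynomial.C ((q⁻¹ : ℚ) : ℂ) *
        (MvPolynomial.X 0 - MvPolynomial.C ((p : ℚ) : ℂ) * MvPolynomial.X 1)]
    let ψ : Fin 2 → MvPolynomial (Fin 2) ℂ :=
      ![MvPolynomial.X 1, MvPolynomial.C ((q⁻¹ : ℚ) : ℂ) *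
        (MvPolynomial.X 0 - MvPolynomial.C ((p : ℚ) : ℂ) * MvPolynomial.X 1 -
          MvPolynomial.C ((r : ℚ) : ℂ))]
    have hφT : ∀ i, φ i ∈ TK := by
      intro i
      fin_cases i
      · exact X_mem_range_mapAlgHom _ 1
      · exact Subalgebra.mul_mem _ (C_rat_mem_range_mapAlgHom _ _)
          (Subalgebra.sub_mem _ (X_mem_range_mapAlgHom _ 0)
            (Subalgebra.mul_mem _ (C_rat_mem_range_mapAlgHom _ _) (X_mem_range_mapAlgHom _ 1)))
    have hψT : ∀ i, ψ i ∈ TQ := by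
      intro i
      fin_cases i
      · exact X_mem_range_mapAlgHom _ 1
      · exact Subalgebra.mul_mem _ (C_rat_mem_range_mapAlgHom _ _)
          (Subalgebra.sub_mem _ (Subalgebra.sub_mem _ (X_mem_range_mapAlgHom _ 0)
            (Subalgebra.mul_mem _ (C_rat_mem_range_mapAlgHom _ _) (X_mem_range_mapAlgHom _ 1)))
            (C_rat_mem_range_mapAlgHom _ _))
    set G' := MvPolynomial.bind₁ φ G with hG'
    set S' := MvPolynomial.bind₁ ψ S with hS'
    have hG'T : ∀ m, IsAlgebraic ℚ (G'.coeff m) :=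
      (forall_isAlgebraic_coeff_iff G').2 (bind₁_mem_range_mapAlgHom _ hGT hφT)
    have hS'T : ∀ m, ∃ q : ℚ, S'.coeff m = q :=
      (forall_exists_rat_coeff_iff S').2 (bind₁_mem_range_mapAlgHom _ hST hψT)
    -- `G' ≠ 0`: the substitution has a left inverse
    have hG'0 : G' ≠ 0 := by
      let φinv : Fin 2 → MvPolynomial (Fin 2) ℂ :=
        ![MvPolynomial.C ((p : ℚ) : ℂ) * MvPolynomial.X 0 + MvPolynomial.C ((q : ℚ) : ℂ) *
          MvPolynomial.X 1, MvPolynomial.X 0]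
      have hinv : MvPolynomial.bind₁ φinv G' = G := by
        rw [hG', MvPolynomial.bind₁_bind₁]
        have key : (fun i => MvPolynomial.bind₁ φinv (φ i)) = MvPolynomial.X := by
          funext i
          fin_cases i
          · simp [φ, φinv]
          · simp only [φ, φinv, Fin.mk_one, Matrix.cons_val_one, map_mul,
              MvPolynomial.bind₁_C_right, map_sub, MvPolynomial.bind₁_X_right,
              Matrix.cons_val_zero]
            have hqq : MvPolynomial.C ((q⁻¹ : ℚ) : ℂ) * MvPolynomial.C ((q : ℚ) : ℂ) =
                (1 : MvPolynomial (Fin 2) ℂ) := by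
              rw [← map_mul, ← map_one MvPolynomial.C]
              congr 1
              push_cast
              field_simp
            linear_combination (MvPolynomial.X 1) * hqq
        rw [key, MvPolynomial.bind₁_X_left, AlgHom.id_apply]
      intro h0
      apply hG0
      rw [← hinv, h0, map_zero]
    -- the transformed identity
    have key : (fun i => MvPolynomial.bind₁ (fun j => MvPolynomial.C ((![0, u 0] : Fin 2 → ℂ) j) +
        MvPolynomial.C c * MvPolynomial.X j) (φ i)) =
        (fun i => MvPolynomial.bind₁ ψ (MvPolynomial.C (u i) + MvPolynomial.C c * MvPolynomial.X i)) := by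
      funext i
      fin_cases i
      · simp [φ, ψ]
      · apply MvPolynomial.funext
        intro z
        simp [φ, ψ]
        field_simp
        linear_combination -hrel
    have h' : MvPolynomial.bind₁ (fun i => MvPolynomial.C ((![0, u 0] : Fin 2 → ℂ) i) +
        MvPolynomial.C c * MvPolynomial.X i) G' = MvPolynomial.C μ * S' := by
      calc MvPolynomial.bind₁ (fun i => MvPolynomial.C ((![0, u 0] : Fin 2 → ℂ) i) +
            MvPolynomial.C c * MvPolynomial.X i) G'
          = MvPolynomial.bind₁ (fun i => MvPolynomial.bind₁ (fun j =>
              MvPolynomial.C ((![0, u 0] : Fin 2 → ℂ) j) + MvPolynomial.C c * MvPolynomial.X j)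
                (φ i)) G := by rw [hG', MvPolynomial.bind₁_bind₁]
        _ = MvPolynomial.bind₁ (fun i => MvPolynomial.bind₁ ψ
              (MvPolynomial.C (u i) + MvPolynomial.C c * MvPolynomial.X i)) G := by rw [key]
        _ = MvPolynomial.bind₁ ψ (MvPolynomial.bind₁ (fun i =>
              MvPolynomial.C (u i) + MvPolynomial.C c * MvPolynomial.X i) G) := by
            rw [MvPolynomial.bind₁_bind₁]
        _ = MvPolynomial.C μ * S' := by rw [h, map_mul, MvPolynomial.bind₁_C_right]
    subst hc
    obtain ⟨γ, J, hγ0, -, hGJ⟩ :=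
      eq_C_mul_X_pow_of_bind₁_affine_eq (hu 0) hind G' S' hG'T hS'T hG'0 h'
    -- evaluate at the transformed point `x' = (p x₀ + q x₁, x₀)`
    set x' : Fin 2 → ℂ := ![(p : ℂ) * x 0 + q * x 1, x 0] with hx'
    have heval : MvPolynomial.eval x' G' = 0 := by
      rw [hG', eval_bind₁]
      have key : (fun i => MvPolynomial.eval x' (φ i)) = x := by
        funext i
        fin_cases i
        · simp [φ, hx']
        · simp only [φ, hx', Fin.mk_one, Matrix.cons_val_one, map_mul,
            MvPolynomial.eval_C, map_sub, MvPolynomial.eval_X, Matrix.cons_val_zero]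
          push_cast
          field_simp
          ring
      rw [key]
      exact hv
    have hx0 : x' 0 = 0 := by
      have h1 : MvPolynomial.eval x' G' = γ * x' 0 ^ J := by
        rw [hGJ]; simp
      rw [heval] at h1
      have h2 : x' 0 ^ J = 0 := by
        rcases mul_eq_zero.1 h1.symm with h | h
        · exact absurd h hγ0
        · exact h
      exact (pow_eq_zero_iff'.1 h2).1
    refine not_linearIndependent_of_rel p q (Or.inr hq) ?_
    simpa [hx'] using hx0

end Literature.NumberTheory.Transcendental.LogLattice
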